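import Literature.Probability.RandomPlanarGeometry.HexSAWStrip
import Mathlib.Analysis.SpecificLimits.Basic
import Mathlib.Analysis.PSeries
import HarnessLib

/-!
# Duminil-Copin–Smirnov: from Lemma 2 to `Z(x_c) = +∞` and `μ ≥ √(2+√2)`

Topic `Literature/Probability/RandomPlanarGeometry`; third support file for the discharge of
`Literature.Probability.RandomPlanarGeometry.SAW.DuminilCopinSmirnov2012_thm1`. Source: H. Duminil-Copin, S. Smirnov, *The connective
constant of the honeycomb lattice equals `√(2+√2)`*, Ann. of Math. 175 (2012), 1653–1665
(arXiv:1007.0575), §3, proof of Theorem 1, first half: "Observe that sequences `(A^x_{T,L})_L`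
and `(B^x_{T,L})_L` are increasing in `L` and are bounded for `x ≤ x_c` thanks to (3) … Thus they
have limits `A_T^x`, `B_T^x` … `(E^{x_c}_{T,L})_L` decreases and converges to a limit `E_T^{x_c}`
… `1 = c_α A_T^{x_c} + B_T^{x_c} + c_ε E_T^{x_c}` (4). … Suppose that for some `T`,
`E_T^{x_c} > 0` … `Z(x_c) ≥ Σ_L E^{x_c}_{T,L} ≥ Σ_L E^{x_c}_T = +∞` … Assuming on the contrary
that `E_T^{x_c} = 0` for all `T` … `1 = c_α A_T^{x_c} + B_T^{x_c}` (5) … a walk `γ` entering into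
the count of `A_{T+1}` and not into `A_T` has to visit some vertex adjacent to the right edge of
`S_{T+1}`. Cutting `γ` at the first such point …, we uniquely decompose it into two walks
crossing `S_{T+1}` (… bridges), which together are one step longer than `γ` …
`A_{T+1}^{x_c} - A_T^{x_c} ≤ x_c (B_{T+1}^{x_c})²` (6) … `B_T^{x_c} ≥ min[B_1^{x_c}, 1/(c_α x_c)]/T`
… `Z(x_c) ≥ Σ_T B_T^{x_c} = +∞`. This completes the proof of the estimate
`μ ≥ x_c⁻¹ = √(2+√2)`."

## Contents

In `namespace Literature.SAW.HV` (combinatorics, any fugacity `x ≥ 0`):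
* anatomy of mid-edge walks `w :: (l ++ [u])` (`isMidWalk_cons_append_iff`), monotonicity of
  `A_{T,L}`, `B_{T,L}` in `L`, `bridgeLists` and `stripB_eq_sum_bridgeLists` (walks `a → β` are
  self-avoiding walks from `O` to the top level, "bridges");
* `sum_midWalks_pow_le`: `Σ_{γ ⊂ Ω : a → H} x^{ℓ(γ)} ≤ 1 + 2 Σ_{n < |V(Ω)|} cₙ x^{n+1}`
  (`Z` versus the `cₙ` of `hexSawCount`);
* the cutting map (`cutIdx`, `cutFst`, `cutSnd`, `cut_injOn`) and the **cutting inequality**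
  `stripA_succ_le`: `A_{T+1,L} ≤ A_{T,L} + x⁻¹ B_{T+1,L} B_{T+1,2L}`;
* `sum_stripE_le`, `sum_stripB_le`: the walks counted in `E_{T,L}` (`L` varying) resp. `B_{T,L}`
  (`T` varying) are distinct; `sq_le_stripB_one`: `B_{1,L} ≥ x²`.
In `namespace Literature.SAW` (consequences of the named fact `DuminilCopinSmirnov2012_lemma2`):
* `HV.stripAlim`, `HV.stripBlim`, `HV.stripElim` (`A_T`, `B_T`, `E_T` at `x_c`), `lemma2_lim` (4),
  `stripAlim_succ_le` (6), `stripElim_eq_zero`, `stripBlim_le_succ`, `stripBlim_ge`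
  (`B_T ≥ m/T`), `not_summable_of_lemma2` (`Z(x_c) = ∞` as `¬ Summable (cₙ x_cⁿ)`),
  `sqrt_le_hexConnectiveConstant_of_lemma2` (`√(2+√2) ≤ μ`).

## Remarks

* In (6) the printed factor `x_c` should be `x_c⁻¹` (`ℓ(γ₁) + ℓ(γ₂) = ℓ(γ) + 1`); the argument
  is unchanged (any positive constant works), we prove and use the correct form.
* The second bridge of the cut is translated horizontally to start at `a`; inside the finite
  trapezoid `S_{T+1,L}` this lands in `S_{T+1,2L}`, whence the `2L` (immaterial after `L → ∞`).
* Both cases of DCS's dichotomy (`E_T > 0` for some `T` / `E_T = 0` for all `T`) are run under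
  the hypothesis `Summable (cₙ x_cⁿ)`, which first forces `E_T = 0` and then contradicts the
  harmonic divergence of `Σ B_T`.
-/

noncomputable section

open Finset Filter Topology Literature.Probability.LatticeModels Literature.Probability.Percolation

namespace Literature.Probability.RandomPlanarGeometry.SAW

namespace HV

/-! ### Mid-edge walks as `w :: (l ++ [u])` -/

/-- The vertex visited before the last one of the inner list `l` (the outer vertex `w` if `l`
has one element). [cite: DuminilCopinSmirnov2012, §1] -/
def prevOf (l : List HV) : HV := (wOut :: l.dropLast).getLast (List.cons_ne_nil _ _)

/-- Anatomy of a mid-edge walk with inner list `l ≠ []` and exit vertex `u`.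
[cite: DuminilCopinSmirnov2012, §1] -/
theorem isMidWalk_cons_append_iff (V : Finset HV) {l : List HV} (hl : l ≠ []) (u : HV) :
    IsMidWalk V (wOut :: (l ++ [u])) ↔
      l.IsChain hvGraph.Adj ∧ l.head? = some hvOrigin ∧ hvGraph.Adj (l.getLast hl) u ∧
        (∀ x ∈ l, x ∈ V) ∧ l.Nodup ∧ u ≠ prevOf l := by
  have hinner : inner (wOut :: (l ++ [u])) = l := by simp [inner]
  have hnr : (wOut :: (l ++ [u])).dropLast.dropLast.getLast? ≠ (wOut :: (l ++ [u])).getLast? ↔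
      u ≠ prevOf l := by
    have e1 : (wOut :: (l ++ [u])).getLast? = some u := by
      rw [List.getLast?_eq_some_getLast (List.cons_ne_nil _ _)]; simp
    have e2 : (wOut :: (l ++ [u])).dropLast.dropLast.getLast? = some (prevOf l) := by
      rw [← List.cons_append, List.dropLast_concat, List.dropLast_cons_of_ne_nil hl,
        List.getLast?_eq_some_getLast (List.cons_ne_nil _ _)]; rfl
    rw [e1, e2, Ne, Ne, Option.some_inj, eq_comm]
  have hhead : (l ++ [u]).head? = some hvOrigin ↔ l.head? = some hvOrigin := by
    cases l with
    | nil => exact absurd rfl hl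
    | cons a l => simp
  constructor
  · rintro ⟨hc, -, hh, hV, hnd, hne⟩
    rw [hinner] at hV hnd
    have hc' := (List.isChain_cons.1 hc).2
    rw [List.isChain_append] at hc'
    refine ⟨hc'.1, hhead.1 hh, ?_, hV, hnd, hnr.1 hne⟩
    exact hc'.2.2 _ (by rw [List.getLast?_eq_some_getLast hl]; rfl) u rfl
  · rintro ⟨hc, hh, hadj, hV, hnd, hne⟩
    refine ⟨?_, rfl, hhead.2 hh, by rwa [hinner], by rwa [hinner], hnr.2 hne⟩
    apply List.IsChain.cons_of_ne_nil (by simp)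
    · exact List.IsChain.append hc (by simp) fun x hx y hy => by
        rw [List.getLast?_eq_some_getLast hl, Option.mem_def, Option.some_inj] at hx
        simp only [List.head?_cons, Option.mem_def, Option.some_inj] at hy
        subst hx; subst hy; exact hadj
    · cases l with
      | nil => exact absurd rfl hl
      | cons a l =>
        simp only [List.head?_cons, Option.some.injEq] at hh
        subst hh; simpa using adj_wOut_hvOrigin


/-- Every mid-edge walk is the trivial one or of the form `w :: (l ++ [u])` with `l ≠ []`.
[cite: DuminilCopinSmirnov2012, §1] -/
theorem IsMidWalk.trivial_or_exists {V : Finset HV} {P : List HV} (h : IsMidWalk V P) :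
    P = [wOut, hvOrigin] ∨ ∃ (l : List HV) (u : HV), l ≠ [] ∧ P = wOut :: (l ++ [u]) := by
  obtain ⟨Q, rfl⟩ := h.exists_eq_cons
  rcases Q.eq_nil_or_concat' with rfl | ⟨L, b, rfl⟩
  · exact Or.inl rfl
  · exact Or.inr ⟨hvOrigin :: L, b, List.cons_ne_nil _ _, by simp⟩

/-- The inner list of `w :: (l ++ [u])` is `l`. [folklore] -/
@[simp] theorem inner_cons_append (l : List HV) (u : HV) : inner (wOut :: (l ++ [u])) = l := by
  simp [inner]

/-- `ℓ(w :: (l ++ [u])) = |l|`. [cite: DuminilCopinSmirnov2012, §1] -/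
@[simp] theorem mwLen_cons_append (l : List HV) (u : HV) : mwLen (wOut :: (l ++ [u])) = l.length := by
  simp [mwLen]

/-- The final half-edge of `w :: (l ++ [u])` is `(l.last, u)`. [cite: DuminilCopinSmirnov2012, §1] -/
theorem finalDart_cons_append {l : List HV} (hl : l ≠ []) (u : HV) :
    finalDart (wOut :: (l ++ [u])) = (l.getLast hl, u) := by
  refine Prod.ext ?_ ?_
  · simp only [finalDart]
    rw [← List.cons_append, List.dropLast_concat, List.getLast?_eq_some_getLast (List.cons_ne_nil _ _),
      Option.getD_some, List.getLast_cons hl]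
  · simp only [finalDart]
    rw [List.getLast?_eq_some_getLast (List.cons_ne_nil _ _), Option.getD_some]
    simp

/-- The final half-edge of the trivial walk is `a` itself, entered from outside. [folklore] -/
@[simp] theorem finalDart_trivial : finalDart [wOut, hvOrigin] = (wOut, hvOrigin) := rfl
/-- The trivial walk has length `0`. [cite: DuminilCopinSmirnov2012, §3 ("F(a) = 1")] -/
@[simp] theorem mwLen_trivial : mwLen [wOut, hvOrigin] = 0 := rfl

/-! ### Partition functions: nonnegativity and monotonicity in `L` -/

/-- `midWalks` is monotone in the domain. [cite: DuminilCopinSmirnov2012, §3] -/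
theorem midWalks_mono {V W : Finset HV} (h : V ⊆ W) : midWalks V ⊆ midWalks W := fun _ hP =>
  mem_midWalks_iff.2 ((mem_midWalks_iff.1 hP).mono h)

section Mono

variable {T L L' : ℕ} {x : ℝ}

/-- `A_{T,L}(x) ≥ 0`. [cite: DuminilCopinSmirnov2012, §3] -/
theorem stripA_nonneg (hx : 0 ≤ x) : 0 ≤ stripA T L x := sum_nonneg fun _ _ => pow_nonneg hx _
/-- `B_{T,L}(x) ≥ 0`. [cite: DuminilCopinSmirnov2012, §3] -/
theorem stripB_nonneg (hx : 0 ≤ x) : 0 ≤ stripB T L x := sum_nonneg fun _ _ => pow_nonneg hx _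
/-- `E_{T,L}(x) ≥ 0`. [cite: DuminilCopinSmirnov2012, §3] -/
theorem stripE_nonneg (hx : 0 ≤ x) : 0 ≤ stripE T L x := sum_nonneg fun _ _ => pow_nonneg hx _

/-- "`(A_{T,L})_L` is increasing in `L`". [cite: DuminilCopinSmirnov2012, §3] -/
theorem stripA_mono_L (hx : 0 ≤ x) (h : L ≤ L') : stripA T L x ≤ stripA T L' x :=
  sum_le_sum_of_subset_of_nonneg (filter_subset_filter _ (midWalks_mono (stripV_mono_L h)))
    fun _ _ _ => pow_nonneg hx _

/-- "`(B_{T,L})_L` is increasing in `L`". [cite: DuminilCopinSmirnov2012, §3] -/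
theorem stripB_mono_L (hx : 0 ≤ x) (h : L ≤ L') : stripB T L x ≤ stripB T L' x :=
  sum_le_sum_of_subset_of_nonneg (filter_subset_filter _ (midWalks_mono (stripV_mono_L h)))
    fun _ _ _ => pow_nonneg hx _

end Mono

/-! ### `B_{T,L}` as a sum over bridges (vertex self-avoiding walks across the strip) -/

/-- The vertex above a type-`1` vertex `v` (across the horizontal edge of `ℍ` at `v`).
[cite: DuminilCopinSmirnov2012, §3] -/
def upOf (v : HV) : HV := (v.1, v.2.1 + 1, false)

/-- Levels of vertices of `S_{T,L}` lie in `[0, 2T-1]`. [cite: DuminilCopinSmirnov2012, §3] -/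
theorem lev_mem_of_mem_stripV {T L : ℕ} {v : HV} (h : v ∈ stripV T L) : 0 ≤ lev v ∧ lev v ≤ 2 * T - 1 := by
  rw [mem_stripV_iff] at h
  obtain ⟨a, b, c⟩ := v
  cases c <;> simp at h ⊢ <;> omega

/-- `prevOf l` is `w` or a member of `l`. [folklore] -/
theorem prevOf_mem (l : List HV) : prevOf l = wOut ∨ prevOf l ∈ l := by
  unfold prevOf
  have := List.getLast_mem (List.cons_ne_nil wOut l.dropLast)
  rcases List.mem_cons.1 this with h | h
  · exact Or.inl h
  · exact Or.inr (List.dropLast_subset l h)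

/-- The **bridges of width `T`** inside `S_{T,L}`: inner vertex lists of the walks `a → β`, i.e.
self-avoiding walks from `O` in `S_{T,L}` ending on the top level `2T - 1`.
[cite: DuminilCopinSmirnov2012, §3 ("bridges")] -/
def bridgeLists (T L : ℕ) : Finset (List HV) :=
  ((midWalks (stripV T L)).filter fun P => IsBetaDart T (finalDart P)).image inner

/-- A walk `a → β` is `w :: (l ++ [upOf (last l)])` with `l` a bridge. [cite: DuminilCopinSmirnov2012, §3] -/
theorem eq_of_isBetaDart {T L : ℕ} (hT : 1 ≤ T) {P : List HV} (hP : IsMidWalk (stripV T L) P)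
    (hβ : IsBetaDart T (finalDart P)) :
    ∃ (l : List HV) (hl : l ≠ []), P = wOut :: (l ++ [upOf (l.getLast hl)]) ∧
      lev (l.getLast hl) = 2 * T - 1 := by
  rcases hP.trivial_or_exists with rfl | ⟨l, u, hl, rfl⟩
  · exfalso
    rw [finalDart_trivial] at hβ
    obtain ⟨h1, -, -⟩ := hβ
    simp [wOut] at h1
    omega
  · rw [finalDart_cons_append hl] at hβ
    obtain ⟨h1, h2, h3⟩ := hβ
    dsimp only at h1 h2 h3
    refine ⟨l, hl, by rw [h3]; rfl, ?_⟩
    simp only [lev, bit, h2, if_true]; omega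

/-- Membership in `bridgeLists`. [cite: DuminilCopinSmirnov2012, §3] -/
theorem mem_bridgeLists_iff {T L : ℕ} (hT : 1 ≤ T) {l : List HV} :
    l ∈ bridgeLists T L ↔ l.IsChain hvGraph.Adj ∧ l.head? = some hvOrigin ∧ l.Nodup ∧
      (∀ x ∈ l, x ∈ stripV T L) ∧ ∃ h : l ≠ [], lev (l.getLast h) = 2 * T - 1 := by
  rw [bridgeLists, mem_image]
  constructor
  · rintro ⟨P, hP, rfl⟩
    rw [mem_filter, mem_midWalks_iff] at hP
    obtain ⟨l, hl, rfl, hlev⟩ := eq_of_isBetaDart hT hP.1 hP.2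
    rw [inner_cons_append]
    obtain ⟨hc, hh, -, hV, hnd, -⟩ := (isMidWalk_cons_append_iff _ hl _).1 hP.1
    exact ⟨hc, hh, hnd, hV, hl, hlev⟩
  · rintro ⟨hc, hh, hnd, hV, hl, hlev⟩
    refine ⟨wOut :: (l ++ [upOf (l.getLast hl)]), ?_, inner_cons_append _ _⟩
    have htyp : (l.getLast hl).2.2 = true := by
      by_contra hf
      rw [Bool.not_eq_true] at hf
      simp [lev, bit, hf] at hlev; omega
    have hup : lev (upOf (l.getLast hl)) = 2 * T := by
      simp [upOf, lev, bit, htyp] at hlev ⊢; omega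
    rw [mem_filter, mem_midWalks_iff, isMidWalk_cons_append_iff _ hl, finalDart_cons_append hl]
    refine ⟨⟨hc, hh, ?_, hV, hnd, ?_⟩, ?_, htyp, rfl⟩
    · -- the vertex above is adjacent
      simp [upOf, hvGraph_adj, AdjRel, htyp]
    · -- no reversal: the vertex above has level `2T`, beyond `w` and `S_{T,L}`
      intro h
      rw [h] at hup
      rcases prevOf_mem l with h' | h'
      · rw [h'] at hup; simp [wOut, lev] at hup; omega
      · have := (lev_mem_of_mem_stripV (hV _ h')).2
        omega
    · dsimp only
      simp [lev, bit, htyp] at hlev; omega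

/-- `B_{T,L}(x) = Σ_{bridges l of S_{T,L}} x^{|l|}`. [cite: DuminilCopinSmirnov2012, §3] -/
theorem stripB_eq_sum_bridgeLists {T L : ℕ} (hT : 1 ≤ T) (x : ℝ) :
    stripB T L x = ∑ l ∈ bridgeLists T L, x ^ l.length := by
  rw [stripB, bridgeLists, sum_image]
  · refine sum_congr rfl fun P hP => ?_
    rw [mem_filter, mem_midWalks_iff] at hP
    rw [hP.1.length_inner]
  · intro P hP P' hP' h
    rw [mem_coe, mem_filter, mem_midWalks_iff] at hP hP'
    obtain ⟨l, hl, rfl, -⟩ := eq_of_isBetaDart hT hP.1 hP.2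
    obtain ⟨l', hl', rfl, -⟩ := eq_of_isBetaDart hT hP'.1 hP'.2
    simp only [inner_cons_append] at h
    subst h; rfl

/-! ### The total mass of mid-edge walks is controlled by `cₙ` -/

/-- The vertex before the last is adjacent to the last. [folklore] -/
theorem adj_prevOf_getLast {l : List HV} (hl : l ≠ []) (hc : l.IsChain hvGraph.Adj)
    (hh : l.head? = some hvOrigin) : hvGraph.Adj (prevOf l) (l.getLast hl) := by
  obtain ⟨l', a, rfl⟩ : ∃ l' a, l = l' ++ [a] := by
    rcases l.eq_nil_or_concat' with rfl | ⟨L, b, rfl⟩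
    · exact absurd rfl hl
    · exact ⟨L, b, rfl⟩
  simp only [prevOf, List.dropLast_concat, List.getLast_append_singleton]
  rcases eq_or_ne l' [] with rfl | hl'
  · simp only [List.nil_append, List.head?_cons, Option.some.injEq] at hh
    subst hh; simpa using adj_wOut_hvOrigin
  · rw [List.getLast_cons hl']
    rw [List.isChain_append] at hc
    exact hc.2.2 _ (by rw [List.getLast?_eq_some_getLast hl']; rfl) a rfl

/-- The neighbour list has three distinct entries. [folklore] -/
theorem nbrs_nodup_length (v : HV) : (nbrs v).Nodup ∧ (nbrs v).length = 3 := by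
  obtain ⟨a, b, c⟩ := v
  cases c
  · simp [nbrs]; omega
  · simp [nbrs]

/-- At most two exits extend a given inner list to a self-avoiding mid-edge walk (the third
neighbour of the last vertex is the previous one). [cite: DuminilCopinSmirnov2012, §1] -/
theorem card_filter_inner_eq_le_two (V : Finset HV) {l : List HV} (hl : l ≠ [])
    (hc : l.IsChain hvGraph.Adj) (hh : l.head? = some hvOrigin) :
    #((midWalks V).filter fun P => inner P = l) ≤ 2 := by
  classical
  set U := ((nbrs (l.getLast hl)).erase (prevOf l)).toFinset with hU
  have hUcard : #U ≤ 2 := by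
    rw [hU]
    refine (List.toFinset_card_le _).trans ?_
    rw [List.length_erase_of_mem ((hvGraph_adj_iff_mem_nbrs _ _).1
      ((adj_prevOf_getLast hl hc hh).symm)), (nbrs_nodup_length _).2]
  refine le_trans ?_ ((card_image_le (f := fun u => wOut :: (l ++ [u])) (s := U)).trans hUcard)
  refine card_le_card fun P hP => ?_
  rw [mem_filter, mem_midWalks_iff] at hP
  rw [mem_image]
  rcases hP.1.trivial_or_exists with rfl | ⟨l', u, hl', rfl⟩
  · exfalso; apply hl; rw [← hP.2]; rfl
  · rw [inner_cons_append] at hP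
    obtain ⟨hP, rfl⟩ := hP
    obtain ⟨-, -, hadj, -, -, hne⟩ := (isMidWalk_cons_append_iff _ hl' _).1 hP
    refine ⟨u, ?_, rfl⟩
    rw [hU, List.mem_toFinset, (nbrs_nodup_length _).1.mem_erase_iff]
    exact ⟨hne, (hvGraph_adj_iff_mem_nbrs _ _).1 hadj⟩

/-- The inner list of a nontrivial mid-edge walk in `V` is an `n`-step self-avoiding walk from
`O` with `n < |V|`. [cite: DuminilCopinSmirnov2012, §1] -/
theorem inner_mem_biUnion_sawFin {V : Finset HV} {P : List HV} (hP : IsMidWalk V P)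
    (hne : P ≠ [wOut, hvOrigin]) :
    inner P ∈ (range V.card).biUnion fun n => sawFin hvOrigin n := by
  rcases hP.trivial_or_exists with rfl | ⟨l, u, hl, rfl⟩
  · exact absurd rfl hne
  obtain ⟨hc, hh, -, hV, hnd, -⟩ := (isMidWalk_cons_append_iff _ hl _).1 hP
  have hlen := hP.mwLen_le_card
  rw [mwLen_cons_append] at hlen
  have hpos := List.length_pos_of_ne_nil hl
  have hO : hvOrigin ∈ V := by
    cases l with
    | nil => exact absurd rfl hl
    | cons a l => simp at hh; subst hh; exact hV _ (by simp)
  have hVpos : 0 < V.card := card_pos.2 ⟨_, hO⟩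
  rw [inner_cons_append, mem_biUnion]
  refine ⟨l.length - 1, by rw [mem_range]; omega, mem_sawFin_iff.2 ⟨hc, hh, by omega, hnd⟩⟩

/-- **The total mass of self-avoiding mid-edge walks from `a` in a finite domain `V` is at most
`1 + 2 Σ_{n<|V|} cₙ x^{n+1}`** (`x ≥ 0`): a nontrivial walk is its inner `(ℓ-1)`-step self-avoiding
walk from `O` plus one of at most two final half-edges. [cite: DuminilCopinSmirnov2012, §1 (Z(x))] -/
theorem sum_midWalks_pow_le (V : Finset HV) {x : ℝ} (hx : 0 ≤ x) :
    ∑ P ∈ midWalks V, x ^ mwLen P ≤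
      1 + 2 * ∑ n ∈ range V.card, (hexSawCount n : ℝ) * x ^ (n + 1) := by
  classical
  have htriv : [wOut, hvOrigin] ∈ midWalks V := mem_midWalks_iff.2 (isMidWalk_trivial V)
  rw [← add_sum_erase _ _ htriv, mwLen_trivial, pow_zero]
  gcongr 1 + ?_
  set S := (midWalks V).erase [wOut, hvOrigin] with hS
  set t := (range V.card).biUnion fun n => sawFin hvOrigin n with ht
  have hmaps : ∀ P ∈ S, inner P ∈ t := fun P hP =>
    inner_mem_biUnion_sawFin (mem_midWalks_iff.1 (mem_of_mem_erase hP)) (ne_of_mem_erase hP)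
  have h1 : ∑ P ∈ S, x ^ mwLen P = ∑ P ∈ S, x ^ (inner P).length :=
    sum_congr rfl fun P hP => by rw [(mem_midWalks_iff.1 (mem_of_mem_erase hP)).length_inner]
  rw [h1, show ∑ P ∈ S, x ^ (inner P).length = ∑ l ∈ t, ∑ P ∈ S with inner P = l, x ^ l.length
    from (sum_fiberwise_of_maps_to' hmaps (fun l => x ^ l.length)).symm]
  have h2 : ∀ l ∈ t, ∑ P ∈ S with inner P = l, x ^ l.length ≤ 2 * x ^ l.length := by
    intro l hlt
    rw [sum_const, nsmul_eq_mul]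
    refine mul_le_mul_of_nonneg_right ?_ (pow_nonneg hx _)
    simp only [ht, mem_biUnion, mem_range, mem_sawFin_iff, mem_sawLists_iff] at hlt
    obtain ⟨n, -, hc, hh, hlen, -⟩ := hlt
    have hl : l ≠ [] := by rintro rfl; simp at hlen
    have := card_filter_inner_eq_le_two V hl hc hh
    have hsub : S.filter (fun P => inner P = l) ⊆ (midWalks V).filter fun P => inner P = l :=
      filter_subset_filter _ (erase_subset _ _)
    exact_mod_cast (card_le_card hsub).trans this
  refine (sum_le_sum h2).trans ?_
  rw [← mul_sum, ht, sum_biUnion]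
  · refine mul_le_mul_of_nonneg_left (le_of_eq (sum_congr rfl fun n _ => ?_)) (by norm_num)
    rw [hexSawCount_eq_card, sum_congr rfl fun l hl => by
      rw [((mem_sawFin_iff.1 hl)).2.2.1], sum_const, nsmul_eq_mul]
  · intro n _ m _ hnm
    simp only [Function.onFun, disjoint_left]
    intro l hl hl'
    rw [mem_sawFin_iff] at hl hl'
    exact hnm (by have := hl.2.2.1; have := hl'.2.2.1; omega)

/-! ### The cutting inequality `A_{T+1} - A_T ≤ B_{T+1}² / x` -/

/-- Reindexing inequality: an injection into a finset of nonnegative weights.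
[folklore] -/
theorem sum_le_sum_of_injOn_of_nonneg {ι κ : Type*} [DecidableEq κ] {s : Finset ι} {t : Finset κ}
    (e : ι → κ) (he : Set.InjOn e s) (hst : ∀ a ∈ s, e a ∈ t) (g : κ → ℝ)
    (hg : ∀ b ∈ t, 0 ≤ g b) : ∑ a ∈ s, g (e a) ≤ ∑ b ∈ t, g b := by
  rw [← Finset.sum_image (f := g) he]
  exact sum_le_sum_of_subset_of_nonneg (image_subset_iff.2 hst) fun b hb _ => hg b hb

/-- The walks of `S_{T,L}` are the walks of `S_{T+1,L}` staying in `S_{T,L}`.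
[cite: DuminilCopinSmirnov2012, §3] -/
theorem midWalks_stripV_eq_filter (T L : ℕ) :
    midWalks (stripV T L) =
      (midWalks (stripV (T + 1) L)).filter fun P => ∀ x ∈ inner P, x ∈ stripV T L := by
  ext P
  rw [mem_filter, mem_midWalks_iff, mem_midWalks_iff]
  constructor
  · exact fun h => ⟨h.mono (stripV_mono_T (Nat.le_succ T)), h.2.2.2.1⟩
  · rintro ⟨h, hV⟩
    exact ⟨h.1, h.2.1, h.2.2.1, hV, h.2.2.2.2.1, h.2.2.2.2.2⟩

/-- The lower neighbour of a type-`0` vertex is unique. [folklore] -/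
theorem eq_of_adj_of_lev_lt {v w : HV} (hv : v.2.2 = false) (hadj : hvGraph.Adj v w)
    (hlt : lev w < lev v) : w = (v.1, v.2.1 - 1, true) := by
  obtain ⟨a, b, c⟩ := v
  obtain ⟨a', b', c'⟩ := w
  simp only at hv; subst hv
  cases c' <;> simp [hvGraph_adj, AdjRel, lev, bit] at hadj hlt ⊢
  omega

/-- A vertex of `S_{T+1,L}` outside `S_{T,L}` has level `2T` or `2T+1`.
[cite: DuminilCopinSmirnov2012, §3] -/
theorem lev_of_mem_sdiff {T L : ℕ} {v : HV} (h1 : v ∈ stripV (T + 1) L) (h2 : v ∉ stripV T L) :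
    lev v = 2 * T ∨ lev v = 2 * T + 1 := by
  rw [mem_stripV_iff] at h1 h2
  push_cast at h1
  omega

/-- "A walk entering into the count of `A_{T+1}` and not into `A_T` has to visit some vertex
adjacent to the right edge of `S_{T+1}`", i.e. a vertex of the top level `2T + 1`.
[cite: DuminilCopinSmirnov2012, §3 (proof of (6))] -/
theorem exists_getElem_lev_eq {T L : ℕ} (hT : 1 ≤ T) {l : List HV} (hc : l.IsChain hvGraph.Adj)
    (hh : l.head? = some hvOrigin) (hnd : l.Nodup) (hV : ∀ v ∈ l, v ∈ stripV (T + 1) L)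
    (hl : l ≠ []) (hlast : lev (l.getLast hl) = 0) (hout : ∃ v ∈ l, v ∉ stripV T L) :
    ∃ (i : ℕ) (hi : i < l.length), lev l[i] = 2 * T + 1 := by
  obtain ⟨v, hvl, hvout⟩ := hout
  obtain ⟨i, hi, rfl⟩ := List.mem_iff_getElem.1 hvl
  rcases lev_of_mem_sdiff (hV _ hvl) hvout with hlev | hlev
  swap
  · exact ⟨i, hi, hlev⟩
  -- `l[i]` has level `2T`: it is entered and left through level `2T ± 1`, and its lower
  -- neighbour is unique, so one of `l[i-1]`, `l[i+1]` has level `2T+1`.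
  have hi0 : i ≠ 0 := by
    rintro rfl
    cases l with
    | nil => exact absurd rfl hl
    | cons a l =>
      simp only [List.head?_cons, Option.some.injEq] at hh
      subst hh
      simp [hvOrigin, lev, bit] at hlev; omega
  have hil : i + 1 < l.length := by
    by_contra hcon
    have : i = l.length - 1 := by omega
    subst this
    rw [← List.getLast_eq_getElem hl, hlast] at hlev; omega
  have htyp : (l[i]).2.2 = false := by
    by_contra hf; rw [Bool.not_eq_false] at hf
    simp [lev, bit, hf] at hlev; omega
  have h1 := hc.getElem (i - 1) (by omega)
  have h2 := hc.getElem i hil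
  simp only [show i - 1 + 1 = i by omega] at h1
  rcases lev_eq_of_adj h2 with h2l | h2l
  · exact ⟨i + 1, hil, by rw [h2l, hlev]⟩
  rcases lev_eq_of_adj h1.symm with h1l | h1l
  · exact ⟨i - 1, by omega, by rw [h1l, hlev]⟩
  -- both neighbours below: they coincide, contradicting `Nodup`
  exfalso
  have e1 := eq_of_adj_of_lev_lt htyp h1.symm (by omega)
  have e2 := eq_of_adj_of_lev_lt htyp h2 (by omega)
  have := (List.Nodup.getElem_inj_iff hnd).1 (e1.trans e2.symm)
  omega


/-- Horizontal translations preserve the type bit. [folklore] -/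
@[simp] theorem bit_shift_zero (a : ℤ) (v : HV) : bit (shift a 0 v) = bit v := by
  obtain ⟨p, q, c⟩ := v; cases c <;> simp [bit]

/-- Horizontal translations preserve levels. [folklore] -/
@[simp] theorem lev_shift_zero (a : ℤ) (v : HV) : lev (shift a 0 v) = lev v := by
  obtain ⟨p, q, c⟩ := v; cases c <;> simp [lev, bit]

/-! ### The cutting map: first visit to the top level -/

section Cut

/-- The cut index of an inner list: the first visit to the top level `2T + 1` of `S_{T+1}`.
[cite: DuminilCopinSmirnov2012, §3 (proof of (6))] -/
def cutIdx (T : ℕ) (l : List HV) : ℕ := l.findIdx fun v => lev v == 2 * (T : ℤ) + 1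

/-- The first piece `[O, …, l[i]]` of the cut walk (a bridge of `S_{T+1,L}`).
[cite: DuminilCopinSmirnov2012, §3 (proof of (6))] -/
def cutFst (T : ℕ) (l : List HV) : List HV := l.take (cutIdx T l + 1)

/-- The reversed second piece `[l.last, …, l[i]]` of the cut walk, before translation.
[cite: DuminilCopinSmirnov2012, §3 (proof of (6))] -/
def cutRev (T : ℕ) (l : List HV) : List HV := (l.drop (cutIdx T l)).reverse

/-- The second piece, translated horizontally so that it starts at `O` (a bridge of
`S_{T+1,2L}`). [cite: DuminilCopinSmirnov2012, §3 (proof of (6))] -/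
def cutSnd (T : ℕ) (l : List HV) : List HV :=
  (cutRev T l).map (shift (-((cutRev T l).headD hvOrigin).1) 0)

variable {T L : ℕ}

/-- The walks of `A_{T+1,L}` not counted in `A_{T,L}`. [cite: DuminilCopinSmirnov2012, §3] -/
def cutDom (T L : ℕ) : Finset (List HV) :=
  ((midWalks (stripV (T + 1) L)).filter fun P => IsAlphaDart (finalDart P)).filter
    fun P => ¬ ∀ x ∈ inner P, x ∈ stripV T L

/-- Anatomy of a walk of `A_{T+1,L} ∖ A_{T,L}`: inner list `l`, exit below `l.last`, which lies on
level `0`, and a visit to level `2T+1`. [cite: DuminilCopinSmirnov2012, §3 (proof of (6))] -/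
theorem cutDom_spec (hT : 1 ≤ T) {P : List HV} (hP : P ∈ cutDom T L) :
    ∃ (l : List HV) (hl : l ≠ []),
      P = wOut :: (l ++ [((l.getLast hl).1, -1, true)]) ∧ l.IsChain hvGraph.Adj ∧
      l.head? = some hvOrigin ∧ l.Nodup ∧ (∀ x ∈ l, x ∈ stripV (T + 1) L) ∧
      (l.getLast hl).2.1 = 0 ∧ (l.getLast hl).2.2 = false ∧
      cutIdx T l < l.length ∧
      ∀ h : cutIdx T l < l.length, lev (l[cutIdx T l]) = 2 * T + 1 := by
  rw [cutDom, mem_filter, mem_filter, mem_midWalks_iff] at hP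
  obtain ⟨⟨hP, hα⟩, hout⟩ := hP
  rcases hP.trivial_or_exists with rfl | ⟨l, u, hl, rfl⟩
  · rw [finalDart_trivial] at hα
    obtain ⟨h1, -, -⟩ := hα
    simp [wOut] at h1
  rw [finalDart_cons_append hl] at hα
  obtain ⟨h0, hf, hu⟩ := hα
  dsimp only at h0 hf hu
  obtain ⟨hc, hh, -, hV, hnd, -⟩ := (isMidWalk_cons_append_iff _ hl _).1 hP
  rw [inner_cons_append] at hout
  push Not at hout
  have hlast : lev (l.getLast hl) = 0 := by simp [lev, bit, h0, hf]
  obtain ⟨i, hi, hlev⟩ := exists_getElem_lev_eq hT hc hh hnd hV hl hlast hout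
  have hex : ∃ x ∈ l, (fun v => lev v == 2 * (T : ℤ) + 1) x := ⟨l[i], List.getElem_mem hi, by simpa⟩
  have hidx := List.findIdx_lt_length_of_exists hex
  refine ⟨l, hl, by rw [hu], hc, hh, hnd, hV, h0, hf, hidx, fun h => ?_⟩
  have := List.findIdx_getElem (p := fun v => lev v == 2 * (T : ℤ) + 1) (xs := l) (w := h)
  simp at this
  exact this

/-- The first piece is a bridge of `S_{T+1,L}`. [cite: DuminilCopinSmirnov2012, §3 (proof of (6))] -/
theorem cutFst_mem (hT : 1 ≤ T) {P : List HV} (hP : P ∈ cutDom T L) :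
    cutFst T (inner P) ∈ bridgeLists (T + 1) L := by
  obtain ⟨l, hl, rfl, hc, hh, hnd, hV, -, -, hidx, hlev⟩ := cutDom_spec hT hP
  rw [inner_cons_append, mem_bridgeLists_iff (by omega), cutFst]
  have hne : l.take (cutIdx T l + 1) ≠ [] := by simp [hl]
  refine ⟨hc.take _, by rw [List.head?_take]; simpa using hh, hnd.sublist (List.take_sublist _ _),
    fun x hx => hV x (List.mem_of_mem_take hx), hne, ?_⟩
  rw [List.getLast_eq_getElem, List.getElem_take]
  simp only [List.length_take, Nat.min_eq_left (Nat.succ_le_of_lt hidx)]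
  push_cast
  linarith [hlev hidx]

/-- The untranslated second piece runs from `l.last` back to `l[i]`. [folklore] -/
theorem cutRev_spec (hT : 1 ≤ T) {P : List HV} (hP : P ∈ cutDom T L) :
    ∃ (l : List HV) (hl : l ≠ []) (hr : cutRev T l ≠ []), inner P = l ∧
      (cutRev T l).head hr = l.getLast hl ∧ cutIdx T l < l.length ∧
      ∀ h : cutIdx T l < l.length, (cutRev T l).getLast hr = l[cutIdx T l] := by
  obtain ⟨l, hl, rfl, -, -, -, -, -, -, hidx, -⟩ := cutDom_spec hT hP
  have hr : cutRev T l ≠ [] := by simp [cutRev]; omega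
  refine ⟨l, hl, hr, inner_cons_append _ _, ?_, hidx, fun h => ?_⟩
  · simp [cutRev]
  · simp [cutRev]

/-- The second piece is a bridge of `S_{T+1,2L}`. [cite: DuminilCopinSmirnov2012, §3 (proof of (6))] -/
theorem cutSnd_mem (hT : 1 ≤ T) {P : List HV} (hP : P ∈ cutDom T L) :
    cutSnd T (inner P) ∈ bridgeLists (T + 1) (2 * L) := by
  obtain ⟨l, hl, hr, hin, hhead, hidx, hlast⟩ := cutRev_spec hT hP
  obtain ⟨l', hl', hP', hc, hh, hnd, hV, h0, hf, -, hlev⟩ := cutDom_spec hT hP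
  obtain rfl : l = l' := by rw [← hin, hP', inner_cons_append]
  rw [hin, cutSnd, mem_bridgeLists_iff (by omega)]
  set a := ((cutRev T l).headD hvOrigin).1 with ha
  have ha' : a = (l.getLast hl).1 := by
    rw [ha, List.headD_eq_head?_getD, List.head?_eq_some_head hr, Option.getD_some, hhead]
  have hzV := hV _ (List.getLast_mem hl)
  rw [mem_stripV_iff] at hzV
  have habs : -(L : ℤ) ≤ a ∧ a ≤ L := by
    rw [ha']; simp only [h0, bit, hf] at hzV; constructor <;> simp at hzV <;> omega
  refine ⟨?_, ?_, ?_, ?_, by simpa using hr, ?_⟩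
  · -- chain
    rw [List.isChain_map]
    have h1 : (cutRev T l).IsChain (fun x y => hvGraph.Adj x y) := by
      rw [cutRev, List.isChain_reverse]
      exact (hc.drop _).imp fun x y (h : hvGraph.Adj x y) => h.symm
    exact h1.imp fun x y h => (shift (-a) 0).map_rel_iff.2 h
  · -- head
    rw [List.head?_map, List.head?_eq_some_head hr, hhead, Option.map_some, shift_apply]
    simp only [Option.some.injEq, hvOrigin, ha', h0, hf, add_zero]
    simp
  · -- nodup
    exact (List.nodup_reverse.2 (hnd.sublist (List.drop_sublist _ _))).map (shift (-a) 0).injective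
  · -- inside `S_{T+1,2L}`
    intro y hy
    rw [List.mem_map] at hy
    obtain ⟨v, hv, rfl⟩ := hy
    have hv' : v ∈ l := by
      rw [cutRev, List.mem_reverse] at hv; exact List.mem_of_mem_drop hv
    have := hV v hv'
    rw [mem_stripV_iff] at this ⊢
    obtain ⟨p, q, b⟩ := v
    cases b <;> simp [bit, lev] at this ⊢ <;> omega
  · -- last vertex on the top level
    rw [List.getLast_map, hlast hidx, lev_shift_zero]
    have := hlev hidx
    omega

/-- The cutting map is injective on `A_{T+1,L} ∖ A_{T,L}` ("we uniquely decompose it into two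
walks crossing `S_{T+1}`"). [cite: DuminilCopinSmirnov2012, §3 (proof of (6))] -/
theorem cut_injOn (hT : 1 ≤ T) :
    Set.InjOn (fun P => (cutFst T (inner P), cutSnd T (inner P))) (cutDom T L : Set (List HV)) := by
  intro P hP P' hP' h
  simp only [Prod.mk.injEq] at h
  obtain ⟨h1, h2⟩ := h
  obtain ⟨l, hl, hr, hin, -, hidx, hlast⟩ := cutRev_spec hT hP
  obtain ⟨l₀, hl₀, hPeq, -⟩ := cutDom_spec hT hP
  obtain rfl : l = l₀ := by rw [← hin, hPeq, inner_cons_append]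
  obtain ⟨l', hl', hr', hin', -, hidx', hlast'⟩ := cutRev_spec hT hP'
  obtain ⟨l₀', hl₀', hPeq', -⟩ := cutDom_spec hT hP'
  obtain rfl : l' = l₀' := by rw [← hin', hPeq', inner_cons_append]
  rw [hin, hin'] at h1 h2
  suffices hll : l = l' by subst hll; exact hPeq.trans hPeq'.symm
  have hii : cutIdx T l = cutIdx T l' := by
    have := congrArg List.length h1
    simp only [cutFst, List.length_take] at this
    omega
  have hgi : l[cutIdx T l] = l'[cutIdx T l'] := by
    have e1 : (cutFst T l)[cutIdx T l]? = l[cutIdx T l]? := List.getElem?_take_of_lt (by omega)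
    have e2 : (cutFst T l')[cutIdx T l]? = l'[cutIdx T l']? := by
      rw [hii]; exact List.getElem?_take_of_lt (by omega)
    rw [h1] at e1
    have := e1.symm.trans e2
    rwa [List.getElem?_eq_getElem hidx, List.getElem?_eq_getElem hidx', Option.some_inj] at this
  -- the translations agree
  have ha : ((cutRev T l).headD hvOrigin).1 = ((cutRev T l').headD hvOrigin).1 := by
    have := congrArg List.getLast? h2
    rw [cutSnd, cutSnd, List.getLast?_map, List.getLast?_map, List.getLast?_eq_some_getLast hr,
      List.getLast?_eq_some_getLast hr', Option.map_some, Option.map_some, Option.some_inj,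
      hlast hidx, hlast' hidx', hgi] at this
    have := congrArg Prod.fst this
    simp only [shift_apply] at this
    linarith
  rw [cutSnd, cutSnd, ha] at h2
  have h3 : cutRev T l = cutRev T l' := (List.map_injective_iff.2 (RelIso.injective _)) h2
  rw [cutRev, cutRev, List.reverse_inj, hii] at h3
  have h4 : l.take (cutIdx T l') = l'.take (cutIdx T l') := by
    have := congrArg (List.take (cutIdx T l')) h1
    rwa [cutFst, cutFst, hii, List.take_take, List.take_take, min_eq_left (Nat.le_succ _)] at this
  calc l = l.take (cutIdx T l') ++ l.drop (cutIdx T l') := (List.take_append_drop _ _).symm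
    _ = l'.take (cutIdx T l') ++ l'.drop (cutIdx T l') := by rw [h3, h4]
    _ = l' := List.take_append_drop _ _

/-- **The cutting inequality** (DCS (6); the printed factor `x_c` should read `x_c⁻¹`, since the
two bridges together are one vertex longer than the cut walk — harmless for the argument):
`A_{T+1,L} ≤ A_{T,L} + x⁻¹ B_{T+1,L} B_{T+1,2L}` for `x > 0` (the second bridge is translated
horizontally by at most `L`, hence lies in `S_{T+1,2L}`).
[cite: DuminilCopinSmirnov2012, §3, eq. (6)] -/
theorem stripA_succ_le (hT : 1 ≤ T) {x : ℝ} (hx : 0 < x) :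
    stripA (T + 1) L x ≤ stripA T L x + x⁻¹ * (stripB (T + 1) L x * stripB (T + 1) (2 * L) x) := by
  have hsplit : stripA (T + 1) L x = stripA T L x + ∑ P ∈ cutDom T L, x ^ mwLen P := by
    rw [stripA, stripA, cutDom, ← Finset.sum_filter_add_sum_filter_not
      ((midWalks (stripV (T + 1) L)).filter fun P => IsAlphaDart (finalDart P))
      (fun P => ∀ x ∈ inner P, x ∈ stripV T L)]
    congr 2
    rw [midWalks_stripV_eq_filter T L, Finset.filter_filter, Finset.filter_filter]
    exact Finset.filter_congr fun P _ => and_comm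
  rw [hsplit, add_le_add_iff_left]
  have hw : ∀ P ∈ cutDom T L, x ^ mwLen P =
      x⁻¹ * (x ^ (cutFst T (inner P)).length * x ^ (cutSnd T (inner P)).length) := by
    intro P hP
    obtain ⟨l, hl, hr, hin, -, hidx, -⟩ := cutRev_spec hT hP
    obtain ⟨l₀, hl₀, hPeq, -⟩ := cutDom_spec hT hP
    obtain rfl : l = l₀ := by rw [← hin, hPeq, inner_cons_append]
    rw [hPeq, mwLen_cons_append, inner_cons_append, ← pow_add, cutFst, cutSnd, List.length_map,
      cutRev, List.length_reverse, List.length_take, List.length_drop,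
      Nat.min_eq_left (Nat.succ_le_of_lt hidx),
      show cutIdx T l + 1 + (l.length - cutIdx T l) = l.length + 1 by omega, pow_succ]
    field_simp
  rw [Finset.sum_congr rfl hw, ← Finset.mul_sum, stripB_eq_sum_bridgeLists (by omega),
    stripB_eq_sum_bridgeLists (by omega), Finset.sum_mul_sum, ← Finset.sum_product']
  refine mul_le_mul_of_nonneg_left ?_ (inv_nonneg.2 hx.le)
  exact sum_le_sum_of_injOn_of_nonneg (fun P => (cutFst T (inner P), cutSnd T (inner P)))
    (cut_injOn hT) (fun P hP => Finset.mem_product.2 ⟨cutFst_mem hT hP, cutSnd_mem hT hP⟩)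
    (fun p => x ^ p.1.length * x ^ p.2.length) fun _ _ => by positivity

end Cut

/-! ### Disjointness of the boundary classes across strips -/

/-- The last inner vertex of a nontrivial walk lies in the domain. [folklore] -/
theorem finalDart_fst_mem {V : Finset HV} {P : List HV} (hP : IsMidWalk V P)
    (hne : P ≠ [wOut, hvOrigin]) : (finalDart P).1 ∈ V := by
  rcases hP.trivial_or_exists with rfl | ⟨l, u, hl, rfl⟩
  · exact absurd rfl hne
  rw [finalDart_cons_append hl]
  exact ((isMidWalk_cons_append_iff _ hl _).1 hP).2.2.2.1 _ (List.getLast_mem hl)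

/-- The trivial walk does not end on `ε ∪ ε̄`. [folklore] -/
theorem not_isEpsDart_trivial (L : ℕ) : ¬ IsEpsDart L (finalDart [wOut, hvOrigin]) := by
  rw [finalDart_trivial]
  simp [IsEpsDart, wOut, hvOrigin]

/-- The walks `a → ε ∪ ε̄` of `S_{T,L}` for distinct `L` are distinct.
[cite: DuminilCopinSmirnov2012, §3 ("Z(x_c) ≥ Σ_L E_{T,L}")] -/
theorem disjoint_filter_isEpsDart (T : ℕ) {L L' : ℕ} (h : L ≠ L') :
    Disjoint ((midWalks (stripV T L)).filter fun P => IsEpsDart L (finalDart P))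
      ((midWalks (stripV T L')).filter fun P => IsEpsDart L' (finalDart P)) := by
  rw [Finset.disjoint_left]
  intro P hP hP'
  rw [mem_filter, mem_midWalks_iff] at hP hP'
  have hne : P ≠ [wOut, hvOrigin] := by rintro rfl; exact not_isEpsDart_trivial L hP.2
  have hx1 := (mem_stripV_iff.1 (finalDart_fst_mem hP.1 hne)).1
  obtain ⟨-, hP2⟩ := hP
  obtain ⟨-, hP2'⟩ := hP'
  unfold IsEpsDart at hP2 hP2'
  omega

/-- The walks `a → β` of `S_{T,L}` for distinct `T` are distinct.
[cite: DuminilCopinSmirnov2012, §3 ("Z(x_c) ≥ Σ_T B_T")] -/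
theorem disjoint_filter_isBetaDart (L : ℕ) {T T' : ℕ} (h : T ≠ T') :
    Disjoint ((midWalks (stripV T L)).filter fun P => IsBetaDart T (finalDart P))
      ((midWalks (stripV T' L)).filter fun P => IsBetaDart T' (finalDart P)) := by
  rw [Finset.disjoint_left]
  intro P hP hP'
  obtain ⟨h1, -, -⟩ := (mem_filter.1 hP).2
  obtain ⟨h1', -, -⟩ := (mem_filter.1 hP').2
  omega

/-- `Σ_{L ≤ N} E_{T,L}(x) ≤ Σ_{γ ⊂ S_{T,N} : a → H} x^{ℓ(γ)}` (`x ≥ 0`).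
[cite: DuminilCopinSmirnov2012, §3 ("Z(x_c) ≥ Σ_L E_{T,L}")] -/
theorem sum_stripE_le (T N : ℕ) {x : ℝ} (hx : 0 ≤ x) :
    ∑ L ∈ range (N + 1), stripE T L x ≤ ∑ P ∈ midWalks (stripV T N), x ^ mwLen P := by
  simp only [stripE]
  rw [← sum_biUnion]
  · refine sum_le_sum_of_subset_of_nonneg ?_ fun _ _ _ => pow_nonneg hx _
    intro P hP
    simp only [mem_biUnion, mem_range, mem_filter] at hP
    obtain ⟨L, hL, hP, -⟩ := hP
    exact midWalks_mono (stripV_mono_L (by omega)) hP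
  · intro L _ L' _ hLL'
    exact disjoint_filter_isEpsDart T hLL'

/-- `Σ_{T ≤ N} B_{T,L}(x) ≤ Σ_{γ ⊂ S_{N,L} : a → H} x^{ℓ(γ)}` (`x ≥ 0`), summing over `T = 1, …, N`.
[cite: DuminilCopinSmirnov2012, §3 ("Z(x_c) ≥ Σ_T B_T")] -/
theorem sum_stripB_le (N L : ℕ) {x : ℝ} (hx : 0 ≤ x) :
    ∑ T ∈ range N, stripB (T + 1) L x ≤ ∑ P ∈ midWalks (stripV N L), x ^ mwLen P := by
  simp only [stripB]
  rw [← sum_biUnion]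
  · refine sum_le_sum_of_subset_of_nonneg ?_ fun _ _ _ => pow_nonneg hx _
    intro P hP
    simp only [mem_biUnion, mem_range, mem_filter] at hP
    obtain ⟨T, hT, hP, -⟩ := hP
    exact midWalks_mono (stripV_mono_T (by omega)) hP
  · intro T _ T' _ hTT'
    exact disjoint_filter_isBetaDart L (by omega)

/-- `B_{1,L}(x) ≥ x²` for `x ≥ 0`: the walk `a → O → (0,0,1) → β` of two vertices.
[cite: DuminilCopinSmirnov2012, §3 ("B_1 > 0")] -/
theorem sq_le_stripB_one (L : ℕ) {x : ℝ} (hx : 0 ≤ x) : x ^ 2 ≤ stripB 1 L x := by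
  have hmem : [wOut, hvOrigin, (0, 0, true), (0, 1, false)] ∈
      (midWalks (stripV 1 L)).filter fun P => IsBetaDart 1 (finalDart P) := by
    rw [mem_filter, mem_midWalks_iff]
    refine ⟨⟨by decide, rfl, rfl, ?_, by decide, by decide⟩, by decide⟩
    intro v hv
    simp only [inner, List.tail_cons, List.dropLast, List.mem_cons, List.not_mem_nil,
      or_false] at hv
    rw [mem_stripV_iff]
    rcases hv with rfl | rfl <;> simp [hvOrigin, lev, bit]
  have : x ^ 2 = x ^ mwLen [wOut, hvOrigin, (0, 0, true), (0, 1, false)] := rfl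
  rw [stripB, this]
  exact single_le_sum (f := fun P => x ^ mwLen P) (fun _ _ => pow_nonneg hx _) hmem

end HV

/-! ### From Lemma 2 to `Z(x_c) = ∞` and `μ ≥ √(2+√2)` -/

section LowerBound

open HV

/-- `c_α = cos(3π/8) > 0`. [cite: DuminilCopinSmirnov2012, Lemma 2] -/
theorem cos_three_pi_div_eight_pos : 0 < Real.cos (3 * Real.pi / 8) := by
  apply Real.cos_pos_of_mem_Ioo; constructor <;> linarith [Real.pi_pos]

/-- `c_ε = cos(π/4) > 0`. [cite: DuminilCopinSmirnov2012, Lemma 2] -/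
theorem cos_pi_div_four_pos' : 0 < Real.cos (Real.pi / 4) := by
  rw [Real.cos_pi_div_four]; positivity

/-- Under Lemma 2, `A_{T,L}(x_c) ≤ 1/c_α`. [cite: DuminilCopinSmirnov2012, §3 (after Lemma 2)] -/
theorem stripA_le_of_lemma2 (hlem : DuminilCopinSmirnov2012_lemma2) {T : ℕ} (hT : 1 ≤ T)
    (L : ℕ) : stripA T L hexCriticalFugacity ≤ (Real.cos (3 * Real.pi / 8))⁻¹ := by
  have h := hlem T L hT
  have h0 := hexCriticalFugacity_pos_lt_one.1.le
  have hB := stripB_nonneg (T := T) (L := L) h0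
  have hE := stripE_nonneg (T := T) (L := L) h0
  have hc := cos_three_pi_div_eight_pos
  have hc' := cos_pi_div_four_pos'
  rw [inv_eq_one_div, le_div_iff₀ hc]
  nlinarith

/-- Under Lemma 2, `B_{T,L}(x_c) ≤ 1`. [cite: DuminilCopinSmirnov2012, §3 (after Lemma 2)] -/
theorem stripB_le_one_of_lemma2 (hlem : DuminilCopinSmirnov2012_lemma2) {T : ℕ} (hT : 1 ≤ T)
    (L : ℕ) : stripB T L hexCriticalFugacity ≤ 1 := by
  have h := hlem T L hT
  have h0 := hexCriticalFugacity_pos_lt_one.1.le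
  have hA := stripA_nonneg (T := T) (L := L) h0
  have hE := stripE_nonneg (T := T) (L := L) h0
  have hc := cos_three_pi_div_eight_pos
  have hc' := cos_pi_div_four_pos'
  nlinarith

namespace HV

/-- `A_T(x_c) := sup_L A_{T,L}(x_c)` (`= lim_L`, the partition function of walks `a → α ∖ {a}`
in the infinite strip `S_T`). [cite: DuminilCopinSmirnov2012, §3 (A_T)] -/
def stripAlim (T : ℕ) : ℝ := ⨆ L : ℕ, stripA T L hexCriticalFugacity

/-- `B_T(x_c) := sup_L B_{T,L}(x_c)` (`= lim_L`, the partition function of bridges of `S_T`).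
[cite: DuminilCopinSmirnov2012, §3 (B_T)] -/
def stripBlim (T : ℕ) : ℝ := ⨆ L : ℕ, stripB T L hexCriticalFugacity

/-- `E_T(x_c) := lim_L E_{T,L}(x_c)`, expressed through Lemma 2 as `(1 - c_α A_T - B_T)/c_ε`.
[cite: DuminilCopinSmirnov2012, §3 (E_T)] -/
def stripElim (T : ℕ) : ℝ :=
  (1 - Real.cos (3 * Real.pi / 8) * stripAlim T - stripBlim T) / Real.cos (Real.pi / 4)

end HV

variable (hlem : DuminilCopinSmirnov2012_lemma2)
include hlem

/-- `(A_{T,L})_L` is bounded. [cite: DuminilCopinSmirnov2012, §3] -/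
theorem bddAbove_stripA {T : ℕ} (hT : 1 ≤ T) :
    BddAbove (Set.range fun L : ℕ => stripA T L hexCriticalFugacity) :=
  ⟨_, by rintro _ ⟨L, rfl⟩; exact stripA_le_of_lemma2 hlem hT L⟩

/-- `(B_{T,L})_L` is bounded. [cite: DuminilCopinSmirnov2012, §3] -/
theorem bddAbove_stripB {T : ℕ} (hT : 1 ≤ T) :
    BddAbove (Set.range fun L : ℕ => stripB T L hexCriticalFugacity) :=
  ⟨_, by rintro _ ⟨L, rfl⟩; exact stripB_le_one_of_lemma2 hlem hT L⟩

/-- `A_{T,L} ≤ A_T`. [cite: DuminilCopinSmirnov2012, §3] -/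
theorem stripA_le_lim {T : ℕ} (hT : 1 ≤ T) (L : ℕ) : stripA T L hexCriticalFugacity ≤ stripAlim T :=
  le_ciSup (bddAbove_stripA hlem hT) L

/-- `B_{T,L} ≤ B_T`. [cite: DuminilCopinSmirnov2012, §3] -/
theorem stripB_le_lim {T : ℕ} (hT : 1 ≤ T) (L : ℕ) : stripB T L hexCriticalFugacity ≤ stripBlim T :=
  le_ciSup (bddAbove_stripB hlem hT) L

/-- `A_{T,L} → A_T`. [cite: DuminilCopinSmirnov2012, §3] -/
theorem tendsto_stripA {T : ℕ} (hT : 1 ≤ T) :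
    Tendsto (fun L : ℕ => stripA T L hexCriticalFugacity) atTop (𝓝 (stripAlim T)) :=
  tendsto_atTop_ciSup (fun _ _ h => stripA_mono_L hexCriticalFugacity_pos_lt_one.1.le h)
    (bddAbove_stripA hlem hT)

/-- `B_{T,L} → B_T`. [cite: DuminilCopinSmirnov2012, §3] -/
theorem tendsto_stripB {T : ℕ} (hT : 1 ≤ T) :
    Tendsto (fun L : ℕ => stripB T L hexCriticalFugacity) atTop (𝓝 (stripBlim T)) :=
  tendsto_atTop_ciSup (fun _ _ h => stripB_mono_L hexCriticalFugacity_pos_lt_one.1.le h)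
    (bddAbove_stripB hlem hT)

/-- `E_{T,L} = (1 - c_α A_{T,L} - B_{T,L})/c_ε`. [cite: DuminilCopinSmirnov2012, Lemma 2] -/
theorem stripE_eq {T : ℕ} (hT : 1 ≤ T) (L : ℕ) :
    stripE T L hexCriticalFugacity = (1 - Real.cos (3 * Real.pi / 8) *
      stripA T L hexCriticalFugacity - stripB T L hexCriticalFugacity) / Real.cos (Real.pi / 4) := by
  have h := hlem T L hT
  rw [eq_div_iff cos_pi_div_four_pos'.ne']
  linarith

/-- `E_{T,L} → E_T`. [cite: DuminilCopinSmirnov2012, §3] -/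
theorem tendsto_stripE {T : ℕ} (hT : 1 ≤ T) :
    Tendsto (fun L : ℕ => stripE T L hexCriticalFugacity) atTop (𝓝 (stripElim T)) := by
  simp only [stripE_eq hlem hT]
  exact ((((tendsto_stripA hlem hT).const_mul _).const_sub _).sub
    (tendsto_stripB hlem hT)).div_const _

/-- "`(E_{T,L})_L` decreases and converges to `E_T`": `E_T ≤ E_{T,L}`.
[cite: DuminilCopinSmirnov2012, §3] -/
theorem stripElim_le {T : ℕ} (hT : 1 ≤ T) (L : ℕ) : stripElim T ≤ stripE T L hexCriticalFugacity := by
  rw [stripE_eq hlem hT, stripElim]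
  have hA := stripA_le_lim hlem hT L
  have hB := stripB_le_lim hlem hT L
  have hc := cos_three_pi_div_eight_pos
  exact div_le_div_of_nonneg_right (by nlinarith) cos_pi_div_four_pos'.le

/-- `E_T ≥ 0`. [cite: DuminilCopinSmirnov2012, §3] -/
theorem stripElim_nonneg {T : ℕ} (hT : 1 ≤ T) : 0 ≤ stripElim T :=
  ge_of_tendsto' (tendsto_stripE hlem hT) fun _ => stripE_nonneg hexCriticalFugacity_pos_lt_one.1.le

omit hlem in
/-- Passing to the limit in Lemma 2: `1 = c_α A_T + B_T + c_ε E_T` (eq. (4); here by the definition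
of `E_T`). [cite: DuminilCopinSmirnov2012, §3, eq. (4)] -/
theorem lemma2_lim (T : ℕ) :
    1 = Real.cos (3 * Real.pi / 8) * stripAlim T + stripBlim T +
      Real.cos (Real.pi / 4) * stripElim T := by
  rw [stripElim, mul_div_cancel₀ _ cos_pi_div_four_pos'.ne']
  ring

/-- The cutting inequality in the limit: `A_{T+1} ≤ A_T + x_c⁻¹ B_{T+1}²`.
[cite: DuminilCopinSmirnov2012, §3, eq. (6)] -/
theorem stripAlim_succ_le {T : ℕ} (hT : 1 ≤ T) :
    stripAlim (T + 1) ≤ stripAlim T + hexCriticalFugacity⁻¹ * stripBlim (T + 1) ^ 2 := by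
  have h0 := hexCriticalFugacity_pos_lt_one.1
  refine ciSup_le fun L => (stripA_succ_le hT h0).trans ?_
  have hA := stripA_le_lim hlem hT L
  have hB1 := stripB_le_lim hlem (T := T + 1) (by omega) L
  have hB2 := stripB_le_lim hlem (T := T + 1) (by omega) (2 * L)
  have hBn1 := stripB_nonneg (T := T + 1) (L := L) h0.le
  have hBn2 := stripB_nonneg (T := T + 1) (L := 2 * L) h0.le
  have : stripB (T + 1) L hexCriticalFugacity * stripB (T + 1) (2 * L) hexCriticalFugacity ≤
      stripBlim (T + 1) ^ 2 := by rw [sq]; exact mul_le_mul hB1 hB2 hBn2 (hBn1.trans hB1)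
  have hinv : 0 ≤ hexCriticalFugacity⁻¹ := inv_nonneg.2 h0.le
  nlinarith

omit hlem in
/-- The total mass of walks from `a` in a finite domain is at most `1 + 2 x Σ cₙ xⁿ` when the series
converges (`x = x_c`). [cite: DuminilCopinSmirnov2012, §1 (Z(x))] -/
theorem sum_midWalks_le_tsum (hs : Summable fun n => (hexSawCount n : ℝ) * hexCriticalFugacity ^ n)
    (V : Finset HV) : ∑ P ∈ midWalks V, hexCriticalFugacity ^ mwLen P ≤
      1 + 2 * hexCriticalFugacity * ∑' n, (hexSawCount n : ℝ) * hexCriticalFugacity ^ n := by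
  have h0 := hexCriticalFugacity_pos_lt_one.1.le
  refine (sum_midWalks_pow_le V h0).trans ?_
  have : ∑ n ∈ range V.card, (hexSawCount n : ℝ) * hexCriticalFugacity ^ (n + 1) =
      hexCriticalFugacity * ∑ n ∈ range V.card, (hexSawCount n : ℝ) * hexCriticalFugacity ^ n := by
    rw [mul_sum]; exact sum_congr rfl fun n _ => by ring
  rw [this, mul_assoc]
  gcongr
  exact hs.sum_le_tsum _ fun n _ => by positivity

/-- Under Lemma 2, if `Σ cₙ x_cⁿ < ∞` then every `E_T` vanishes ("`Z(x_c) ≥ Σ_L E_{T,L} ≥ Σ_L E_T`").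
[cite: DuminilCopinSmirnov2012, §3 (proof of Theorem 1, first case)] -/
theorem stripElim_eq_zero (hs : Summable fun n => (hexSawCount n : ℝ) * hexCriticalFugacity ^ n)
    {T : ℕ} (hT : 1 ≤ T) : stripElim T = 0 := by
  refine le_antisymm ?_ (stripElim_nonneg hlem hT)
  set Zb := 1 + 2 * hexCriticalFugacity * ∑' n, (hexSawCount n : ℝ) * hexCriticalFugacity ^ n
  have hbound : ∀ N : ℕ, (N + 1) * stripElim T ≤ Zb := by
    intro N
    calc ((N : ℝ) + 1) * stripElim T = ∑ L ∈ range (N + 1), stripElim T := by simp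
      _ ≤ ∑ L ∈ range (N + 1), stripE T L hexCriticalFugacity :=
          sum_le_sum fun L _ => stripElim_le hlem hT L
      _ ≤ ∑ P ∈ midWalks (stripV T N), hexCriticalFugacity ^ mwLen P :=
          sum_stripE_le T N hexCriticalFugacity_pos_lt_one.1.le
      _ ≤ Zb := sum_midWalks_le_tsum hs _
  by_contra hpos
  push Not at hpos
  obtain ⟨N, hN⟩ := exists_nat_gt (Zb / stripElim T)
  have := hbound N
  rw [div_lt_iff₀ hpos] at hN
  nlinarith

/-- Under Lemma 2 and `Σ cₙ x_cⁿ < ∞`: the recursion `B_T ≤ B_{T+1} + (c_α/x_c) B_{T+1}²`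
(from `1 = c_α A_T + B_T`, eq. (5), and the cutting inequality (6)).
[cite: DuminilCopinSmirnov2012, §3 (proof of Theorem 1)] -/
theorem stripBlim_le_succ (hs : Summable fun n => (hexSawCount n : ℝ) * hexCriticalFugacity ^ n)
    {T : ℕ} (hT : 1 ≤ T) :
    stripBlim T ≤ stripBlim (T + 1) +
      Real.cos (3 * Real.pi / 8) * hexCriticalFugacity⁻¹ * stripBlim (T + 1) ^ 2 := by
  have h1 := lemma2_lim T
  have h2 := lemma2_lim (T + 1)
  rw [stripElim_eq_zero hlem hs hT] at h1
  rw [stripElim_eq_zero hlem hs (by omega)] at h2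
  have h3 := stripAlim_succ_le hlem hT
  have hc := cos_three_pi_div_eight_pos
  nlinarith

/-- `B_1 ≥ x_c² > 0`. [cite: DuminilCopinSmirnov2012, §3] -/
theorem stripBlim_one_pos : 0 < stripBlim 1 :=
  lt_of_lt_of_le (by have := hexCriticalFugacity_pos_lt_one.1; positivity)
    ((sq_le_stripB_one 0 hexCriticalFugacity_pos_lt_one.1.le).trans (stripB_le_lim hlem le_rfl 0))

/-- "It follows easily by induction that `B_T ≥ min[B_1, 1/(c_α x_c⁻¹)]/T` for every `T ≥ 1`."
[cite: DuminilCopinSmirnov2012, §3 (proof of Theorem 1)] -/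
theorem stripBlim_ge (hs : Summable fun n => (hexSawCount n : ℝ) * hexCriticalFugacity ^ n)
    (T : ℕ) : min (stripBlim 1) (Real.cos (3 * Real.pi / 8) * hexCriticalFugacity⁻¹)⁻¹ / (T + 1) ≤
      stripBlim (T + 1) := by
  set κ := Real.cos (3 * Real.pi / 8) * hexCriticalFugacity⁻¹ with hκ
  set m := min (stripBlim 1) κ⁻¹ with hm
  have hκpos : 0 < κ := mul_pos cos_three_pi_div_eight_pos (inv_pos.2 hexCriticalFugacity_pos_lt_one.1)
  have hmpos : 0 < m := lt_min (stripBlim_one_pos hlem) (inv_pos.2 hκpos)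
  have hmκ : m * κ ≤ 1 := by
    rw [← le_div_iff₀ hκpos, one_div]; exact min_le_right _ _
  induction T with
  | zero => simp [hm]
  | succ T ih =>
    have hrec := stripBlim_le_succ hlem hs (T := T + 1) (by omega)
    have hBpos : 0 ≤ stripBlim (T + 1 + 1) :=
      (stripB_nonneg hexCriticalFugacity_pos_lt_one.1.le).trans (stripB_le_lim hlem (by omega) 0)
    by_contra hlt
    push Not at hlt
    have hT0 : (0 : ℝ) < T + 1 := by positivity
    have hT1 : (0 : ℝ) < T + 1 + 1 := by positivity
    push_cast at hrec hlt ih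
    -- `f(y) = y + κ y²` is increasing on `y ≥ 0`, so `B_{T+1} < f(m/(T+2))`
    have key : stripBlim (T + 1) < m / (T + 1 + 1) + κ * (m / (T + 1 + 1)) ^ 2 := by
      have hsq : stripBlim (T + 1 + 1) ^ 2 ≤ (m / (T + 1 + 1)) ^ 2 :=
        pow_le_pow_left₀ hBpos hlt.le 2
      have := mul_le_mul_of_nonneg_left hsq hκpos.le
      linarith
    -- and `f(m/(T+2)) ≤ m/(T+1)` since `κ m ≤ 1`
    have key2 : m / (T + 1 + 1) + κ * (m / (T + 1 + 1)) ^ 2 ≤ m / (T + 1) := by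
      rw [← sub_nonneg]
      have : m / (↑T + 1) - (m / (T + 1 + 1) + κ * (m / (T + 1 + 1)) ^ 2) =
          m * ((T + 1 + 1) - (T + 1) * (κ * m)) / ((↑T + 1) * (↑T + 1 + 1) ^ 2) := by
        field_simp
        ring
      rw [this]
      apply div_nonneg _ (by positivity)
      apply mul_nonneg hmpos.le
      have h1 : (T + 1 : ℝ) * (κ * m) ≤ (T + 1) * 1 :=
        mul_le_mul_of_nonneg_left (by rwa [mul_comm] at hmκ) hT0.le
      linarith
    linarith

/-- **`Z(x_c) = +∞`**: under Lemma 2 the series `Σₙ cₙ x_cⁿ` diverges ("`Z(x_c) ≥ Σ_T B_T = +∞`").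
[cite: DuminilCopinSmirnov2012, §3 (proof of Theorem 1, `μ ≥ √(2+√2)`)] -/
theorem not_summable_of_lemma2 :
    ¬ Summable fun n => (hexSawCount n : ℝ) * hexCriticalFugacity ^ n := by
  intro hs
  set Zb := 1 + 2 * hexCriticalFugacity * ∑' n, (hexSawCount n : ℝ) * hexCriticalFugacity ^ n
  set m := min (stripBlim 1) (Real.cos (3 * Real.pi / 8) * hexCriticalFugacity⁻¹)⁻¹
  have hmpos : 0 < m := lt_min (stripBlim_one_pos hlem) (inv_pos.2
    (mul_pos cos_three_pi_div_eight_pos (inv_pos.2 hexCriticalFugacity_pos_lt_one.1)))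
  -- `Σ_{T ≤ N} B_T ≤ Zb`
  have hB : ∀ N : ℕ, ∑ T ∈ range N, stripBlim (T + 1) ≤ Zb := by
    intro N
    have hlim : Tendsto (fun L : ℕ => ∑ T ∈ range N, stripB (T + 1) L hexCriticalFugacity) atTop
        (𝓝 (∑ T ∈ range N, stripBlim (T + 1))) :=
      tendsto_finsetSum _ fun T _ => tendsto_stripB hlem (by omega)
    exact le_of_tendsto' hlim fun L =>
      (sum_stripB_le N L hexCriticalFugacity_pos_lt_one.1.le).trans (sum_midWalks_le_tsum hs _)
  -- hence the harmonic sums are bounded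
  have hH : ∀ N : ℕ, m * ∑ T ∈ range N, (1 / ((T : ℝ) + 1)) ≤ Zb := by
    intro N
    rw [mul_sum]
    refine (sum_le_sum fun T _ => ?_).trans (hB N)
    rw [mul_one_div]
    exact stripBlim_ge hlem hs T
  have hdiv := (Real.tendsto_sum_range_one_div_nat_succ_atTop.const_mul_atTop hmpos)
  rw [tendsto_atTop_atTop] at hdiv
  obtain ⟨N, hN⟩ := hdiv (Zb + 1)
  linarith [hN N le_rfl, hH N]

omit hlem in
/-- If `Σ cₙ xⁿ` diverges for some `x > 0` then `μ ≥ 1/x` (root test, `cₙ^{1/n} → μ`).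
[cite: DuminilCopinSmirnov2012, §1 ("μ = x_c⁻¹ is equivalent to Z(x) = +∞ for x > x_c and
Z(x) < ∞ for x < x_c")] -/
theorem inv_le_hexConnectiveConstant_of_not_summable {x : ℝ} (hx : 0 < x)
    (hs : ¬ Summable fun n => (hexSawCount n : ℝ) * x ^ n) : x⁻¹ ≤ hexConnectiveConstant := by
  by_contra hlt
  push Not at hlt
  obtain ⟨r, hμr, hrx⟩ := exists_between hlt
  have hr0 : 0 < r := hexConnectiveConstant_pos.trans hμr
  have hrx1 : r * x < 1 := by
    have := mul_lt_mul_of_pos_right hrx hx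
    rwa [inv_mul_cancel₀ hx.ne'] at this
  apply hs
  have hev : ∀ᶠ n in atTop, (hexSawCount n : ℝ) ≤ r ^ n := by
    have h1 := tendsto_hexSawCount_rpow.eventually (eventually_lt_nhds hμr)
    filter_upwards [h1, eventually_gt_atTop 0] with n hn hn0
    have hc : (0 : ℝ) ≤ hexSawCount n := by positivity
    have h2 : ((hexSawCount n : ℝ) ^ (1 / (n : ℝ))) ^ (n : ℝ) = hexSawCount n := by
      rw [← Real.rpow_mul hc, one_div, inv_mul_cancel₀ (by exact_mod_cast hn0.ne'), Real.rpow_one]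
    calc (hexSawCount n : ℝ) = ((hexSawCount n : ℝ) ^ (1 / (n : ℝ))) ^ (n : ℝ) := h2.symm
      _ ≤ r ^ (n : ℝ) := Real.rpow_le_rpow (by positivity) hn.le (by positivity)
      _ = r ^ n := Real.rpow_natCast r n
  refine Summable.of_norm_bounded_eventually_nat (g := fun n => (r * x) ^ n)
    (summable_geometric_of_lt_one (by positivity) hrx1) ?_
  filter_upwards [hev] with n hn
  rw [Real.norm_of_nonneg (by positivity), mul_pow]
  exact mul_le_mul_of_nonneg_right hn (by positivity)

/-- **Lower bound of Theorem 1 from Lemma 2**: `√(2+√2) ≤ μ(ℍ)`.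
[cite: DuminilCopinSmirnov2012, §3 (proof of Theorem 1, "μ ≥ x_c⁻¹ = √(2+√2)")] -/
theorem sqrt_le_hexConnectiveConstant_of_lemma2 :
    Real.sqrt (2 + Real.sqrt 2) ≤ hexConnectiveConstant := by
  have := inv_le_hexConnectiveConstant_of_not_summable hexCriticalFugacity_pos_lt_one.1
    (not_summable_of_lemma2 hlem)
  rwa [hexCriticalFugacity, inv_inv] at this

end LowerBound

end Literature.Probability.RandomPlanarGeometry.SAW
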